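import Summits.ResolutionOfSingularities.ResolutionOfSingularities.Theorems.PurelyInseparableDim4ResConeLayer
import Mathlib.Algebra.MvPolynomial.Division
import HarnessLib
import HarnessLib.Audit.Tags

/-!
# Purely inseparable four-folds — the TAME CONE AT A CONSTANT-`d` STEP, III: ALL LAYERS of the new residual
# cone and their BIRTHS from the higher homogeneous components (idea-4 I-4-6 (VT)(ii), layers `m ≥ 1`)

[OURS · counted 0 · cell `res-dim4-pi` · desk WORDs #78 (a) / #80 (a)(b): HANDOFF-g2 item 2 «slice B step formula
with births / layer-`m` of (VT)(ii)»; seat res-dim4-p-12 g3.]  Nothing here proves K2(p), `NoIsolatedTrap p p` or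
resolution of singularities in dimension ≥ 4 / characteristic `p`.  AI kernel work, weaker than expert review.

Setting (`…ResCone`, `…ResConeNear`, `…ResConeTransport`, `…ResConeLayer`): a presented state `s = (F, r, exc)`,
`x^r ∣ F` monomialwise, `ord₀ F = o > q` (`< 2q` where said), residual polynomial `G = F / x^r`
(`s.F.divMonomial s.r`), residual cone `g = resForm s` of degree `d = o − |r|`; point step at the chart point `b`
of the `x_j`-chart (`b_j = 0`), `s′ = CentreBlowup.step q univ j b s`, `r′ = (r|_{b=0}).update j (o − q)`;
`top = topMonomial j b r = x^{r_kept} x_j^A`, `A = r_j + Σ_{b_i ≠ 0} r_i`, `c = coeff_top (shear j b x^r) ≠ 0`.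
`…ResConeLayer` did the `x_j`-FREE layer (`coeff_ν g′ = c · coeff_ν (shear j b g)`, `ν_j = 0`); here ALL layers:
* §1 `coeff_step_F_chartExponent` / `exists_of_mem_support_step`: `coeff_{e′} F′ = [e′ no q-th power] ·
  coeff_e (shear j b F)`, `e′ = chartExponent e`, and every monomial of `F′` arises so (every chart point `b`).
* §2 **`shade_step_eq_iff`** (band `q < o < 2q`): the step KEEPS the shade iff every monomial `x^e` of
  `shear j b F` whose chart image survives the cleaning has `e_j ≤ A + 2(|e| − o)` — THE ABSORPTION LAW (layer
  `F_{o+m}`: sheared `x_j`-exponent `≤ A + 2m`; `m = 0` is «`shear j b g` is `x_j`-free», `…ResConeNear`).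
* §3 **`coeff_resForm_step`**: for `|μ| = d`, `m = μ_j`: `coeff_μ (resForm s′) = [x^{r′+μ} no q-th power] ·
  coeff_{top + μ + m e_j} (shear j b F)` (source in `F_{o+m}`, `x_j`-exponent `A + 2m`); the cleaning bites only
  where `q ∣ (o − q) + m` (`dvd_of_isPthPowerExponent_step_r_add`), never for `o + m < 2q` (`not_dvd_of_add_lt`).
* §4 births on `G`: `apply_le_of_mem_support_shear_divMonomial_of_shade_eq` (honest degree `d + m` ⇒ every
  monomial of `shear j b G` has `x_j`-exponent `≤ 2m`) and **`coeff_resForm_step_eq_mul_coeff_shear_divMonomial`**: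
  `coeff_μ (resForm s′) = c · coeff_{μ + m e_j} (shear j b G)` — layer `m` of `g′` is `c ×` the `x_j^{2m}`-layer of
  `G̃_{d+m}` (idea-4 I-4-6 (VT)(ii): `g′ = Σ_m x_j^m B_m`, `B₀ = c·g̃`, `B_m` = degree-`(d−m)` part of
  `G̃_{d+m}(x̃′, 1)`), for every layer with `q ∤ (o − q) + m` (`_of_add_lt`: layers `0, 1` in the isolated band).
No characteristic hypothesis (`q` any natural number).  bears_on: LADDER-RESOLUTION:D157-DOOR2 (res-dim4-pi ·
K2(p) · I-4-6 (VT)(ii) all layers · slice B/C input).  Supports stmt-ResolutionOfSingularities-16155 (helper).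
-/

set_option linter.dupNamespace false -- mandated namespace of this single-conjunct summit

noncomputable section

namespace Summit.ResolutionOfSingularities.ResolutionOfSingularities.Theorems.PIDim4

namespace ResCone

open MvPolynomial Finset
open Literature.AlgebraicGeometry.Resolution
open Literature.AlgebraicGeometry.Resolution.CentreBlowup
open Literature.AlgebraicGeometry.Resolution.Hauser2010
open Literature.AlgebraicGeometry.Resolution.HauserPerlega2019
open PointBlowup (polarMap additiveSubspace direction)

variable {K : Type} [Field K]

/-! ## 1. Coefficients of the stepped polynomial through the shear (every chart point `b`, `b_j = 0`) -/

section Step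

variable [DecidableEq K]

/-- **Forward reading**: the coefficient of the chart image `x^{e′}`, `e′ = chartExponent e`, in the polynomial
of the point step at `b` is the coefficient of `x^e` in the SHEARED polynomial `shear j b F` — unless `e′` is a
`q`-th power exponent, when the cleaning deletes it. [folklore] -/
theorem coeff_step_F_chartExponent (q : ℕ) (j : Fin 4) {b : Fin 4 → K} (hbj : b j = 0) (s : State K)
    (hq : (q : ℕ∞) ≤ ordAlong Finset.univ s.F) {e : Fin 4 →₀ ℕ} (he : q ≤ e.degree) :
    coeff (chartExponent q Finset.univ j e) (CentreBlowup.step q Finset.univ j b s).F =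
      if IsPthPowerExponent q (chartExponent q Finset.univ j e) then 0 else coeff e (shear j b s.F) := by
  rw [step_F_eq_deletePthPowers_chartTransform_shear q j hbj s hq, coeff_deletePthPowers]
  split_ifs with h
  · rfl
  · exact coeff_chartTransform_chartExponent' (Straightening.le_ordAlong_univ_shear j b hq) he

/-- **Backward reading**: every monomial of `F′` is the chart image of a monomial of `shear j b F`. [folklore] -/
theorem exists_of_mem_support_step (q : ℕ) (j : Fin 4) {b : Fin 4 → K} (hbj : b j = 0) (s : State K)
    (hq : (q : ℕ∞) ≤ ordAlong Finset.univ s.F) {E : Fin 4 →₀ ℕ}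
    (hE : E ∈ (CentreBlowup.step q Finset.univ j b s).F.support) :
    ∃ e ∈ (shear j b s.F).support, chartExponent q Finset.univ j e = E ∧ ¬ IsPthPowerExponent q E := by
  rw [MvPolynomial.mem_support_iff, step_F_eq_deletePthPowers_chartTransform_shear q j hbj s hq,
    coeff_deletePthPowers] at hE
  by_cases hP : IsPthPowerExponent q E
  · exact absurd (if_pos hP) hE
  · rw [if_neg hP] at hE
    unfold chartTransform at hE
    rw [coeff_sum] at hE
    obtain ⟨e, he, hne⟩ := Finset.exists_ne_zero_of_sum_ne_zero hE
    refine ⟨e, he, ?_, hP⟩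
    by_contra hneq
    exact hne (by rw [coeff_monomial, if_neg hneq])

/-! ## 2. The constant-shade condition, read on the sheared polynomial -/

/-- Degree bookkeeping of the new boundary: `|r′| + A = (o − q) + |r|`, `A = top_j = r_j + Σ_{b_i ≠ 0} r_i`.
[folklore] -/
theorem degree_step_r_add_topMonomial (q : ℕ) (j : Fin 4) {b : Fin 4 → K} (hbj : b j = 0) (s : State K)
    {o : ℕ} (ho : ordZero s.F = o) (hr : ∀ d ∈ s.F.support, s.r ≤ d) :
    (CentreBlowup.step q Finset.univ j b s).r.degree + topMonomial j b s.r j = (o - q) + s.r.degree := by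
  have h := degree_step_r q j hbj s ho hr
  rw [topMonomial_apply, if_pos rfl]
  omega

/-- **CONSTANT SHADE ⇒ THE ABSORPTION LAW ON THE SHEARED POLYNOMIAL** (all layers): at a shade-keeping point
step (`x^r ∣ F`, `q < ord₀ F = o`, `b_j = 0`), every monomial `x^e` of `shear j b F` whose chart image survives
the cleaning has `e_j ≤ A + 2 (|e| − o)` (layer `|e| = o + m`: `x_j`-exponent `≤ A + 2m`; `m = 0`: the sheared
residual cone is `x_j`-free, `…ResConeNear`). [OURS] [cite: CossartJannsenSaito2020, Thm. 3.10(4), Thm. 9.3] -/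
theorem apply_add_le_of_mem_support_shear_of_shade_eq {q : ℕ} (j : Fin 4) {b : Fin 4 → K} (hbj : b j = 0)
    {s : State K} {o : ℕ} (ho : ordZero s.F = o) (hr : ∀ d ∈ s.F.support, s.r ≤ d) (hqo : q < o)
    (heq : (CentreBlowup.step q Finset.univ j b s).shade = s.shade) {e : Fin 4 →₀ ℕ}
    (he : e ∈ (shear j b s.F).support) (hnp : ¬ IsPthPowerExponent q (chartExponent q Finset.univ j e)) :
    e j + 2 * o ≤ topMonomial j b s.r j + 2 * e.degree := by
  have hq : (q : ℕ∞) ≤ ordAlong Finset.univ s.F := by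
    rw [ordAlong_univ, ho]; exact_mod_cast hqo.le
  have hq' := Straightening.le_ordAlong_univ_shear j b hq
  have hedeg : q ≤ e.degree := le_degree_of_mem_support hq' he
  have hcoeff : coeff (chartExponent q Finset.univ j e) (CentreBlowup.step q Finset.univ j b s).F ≠ 0 := by
    rw [coeff_step_F_chartExponent q j hbj s hq hedeg, if_neg hnp]
    exact MvPolynomial.mem_support_iff.mp he
  have hord : ordZero (CentreBlowup.step q Finset.univ j b s).F ≤
      ((chartExponent q Finset.univ j e).degree : ℕ∞) :=
    Literature.Barriers.ResolutionOfSingularities.ordZero_le_of_coeff_ne_zero _ _ hcoeff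
  rw [ordZero_step_of_shade_eq j hbj ho hr heq] at hord
  have h1 : (CentreBlowup.step q Finset.univ j b s).r.degree + (o - s.r.degree) ≤
      (chartExponent q Finset.univ j e).degree := by exact_mod_cast hord
  have h2 := degree_chartExponent_univ q j hedeg
  have h3 := degree_step_r_add_topMonomial q j hbj s ho hr
  have hro := degree_r_le ho hr
  omega

/-- The same at an HONEST layer (`q ∤ |e| − q`, the `x_j`-exponent of the chart image): `e_j + 2o ≤ A + 2|e|`.
[OURS] [cite: CossartJannsenSaito2020, Thm. 3.10(4), Thm. 9.3] -/
theorem apply_add_le_of_mem_support_shear_of_shade_eq_of_not_dvd {q : ℕ} (j : Fin 4) {b : Fin 4 → K}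
    (hbj : b j = 0) {s : State K} {o : ℕ} (ho : ordZero s.F = o) (hr : ∀ d ∈ s.F.support, s.r ≤ d)
    (hqo : q < o) (heq : (CentreBlowup.step q Finset.univ j b s).shade = s.shade) {e : Fin 4 →₀ ℕ}
    (he : e ∈ (shear j b s.F).support) (hm : ¬ q ∣ e.degree - q) :
    e j + 2 * o ≤ topMonomial j b s.r j + 2 * e.degree := by
  refine apply_add_le_of_mem_support_shear_of_shade_eq j hbj ho hr hqo heq he fun hP => hm ?_
  have := (isPthPowerExponent_iff q _).mp hP j
  rwa [chartExponent_univ_apply_self] at this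

/-- **THE CONVERSE: the absorption law forces constant shade.**  In the band `q < o < 2q`, if every monomial of
`shear j b F` whose chart image survives the cleaning satisfies `e_j + 2o ≤ A + 2|e|`, the point step at `b`
keeps the shade.  (So «constant `d`» at a chart point is EXACTLY this weighted-order condition on the sheared
polynomial, modulo deleted `q`-th powers.) [OURS] [cite: CossartJannsenSaito2020, Thm. 3.10(4), Thm. 9.3] -/
theorem shade_step_eq_of_forall {q : ℕ} (j : Fin 4) {b : Fin 4 → K} (hbj : b j = 0) {s : State K} {o : ℕ}
    (ho : ordZero s.F = o) (hr : ∀ d ∈ s.F.support, s.r ≤ d) (hqo : q < o) (ho2 : o < 2 * q)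
    (h : ∀ e ∈ (shear j b s.F).support, ¬ IsPthPowerExponent q (chartExponent q Finset.univ j e) →
      e j + 2 * o ≤ topMonomial j b s.r j + 2 * e.degree) :
    (CentreBlowup.step q Finset.univ j b s).shade = s.shade := by
  have hq : (q : ℕ∞) ≤ ordAlong Finset.univ s.F := by
    rw [ordAlong_univ, ho]; exact_mod_cast hqo.le
  have hq' := Straightening.le_ordAlong_univ_shear j b hq
  have h3 := degree_step_r_add_topMonomial q j hbj s ho hr
  have hro := degree_r_le ho hr
  apply le_antisymm
  · refine (shade_step_le j hbj ho hr hqo ho2).trans ?_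
    rw [BandShade.shade_eq_coe ho]
    exact_mod_cast Nat.sub_le _ _
  · have hord : (((CentreBlowup.step q Finset.univ j b s).r.degree + (o - s.r.degree) : ℕ) : ℕ∞) ≤
        ordZero (CentreBlowup.step q Finset.univ j b s).F := by
      refine Literature.Barriers.ResolutionOfSingularities.le_ordZero_of_forall _ _ fun E hE => ?_
      obtain ⟨e, he, heE, hnp⟩ := exists_of_mem_support_step q j hbj s hq (MvPolynomial.mem_support_iff.mpr hE)
      have hedeg : q ≤ e.degree := le_degree_of_mem_support hq' he
      have h1 := h e he (heE ▸ hnp)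
      have h2 := degree_chartExponent_univ q j hedeg
      rw [← heE]
      omega
    rw [BandShade.shade_eq_coe ho]
    unfold CState.shade
    calc ((o - s.r.degree : ℕ) : ℕ∞)
        = (((CentreBlowup.step q Finset.univ j b s).r.degree + (o - s.r.degree) : ℕ) : ℕ∞) -
            ((CentreBlowup.step q Finset.univ j b s).r.degree : ℕ∞) := by
          rw [← ENat.coe_sub]; norm_cast; omega
      _ ≤ ordZero (CentreBlowup.step q Finset.univ j b s).F -
            ((CentreBlowup.step q Finset.univ j b s).r.degree : ℕ∞) := tsub_le_tsub_right hord _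

/-- **Constant shade ⟺ the absorption law** (band `q < o < 2q`, `x^r ∣ F`, `b_j = 0`). [OURS]
[cite: CossartJannsenSaito2020, Thm. 3.10(4), Thm. 9.3] -/
theorem shade_step_eq_iff {q : ℕ} (j : Fin 4) {b : Fin 4 → K} (hbj : b j = 0) {s : State K} {o : ℕ}
    (ho : ordZero s.F = o) (hr : ∀ d ∈ s.F.support, s.r ≤ d) (hqo : q < o) (ho2 : o < 2 * q) :
    (CentreBlowup.step q Finset.univ j b s).shade = s.shade ↔
      ∀ e ∈ (shear j b s.F).support, ¬ IsPthPowerExponent q (chartExponent q Finset.univ j e) →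
        e j + 2 * o ≤ topMonomial j b s.r j + 2 * e.degree :=
  ⟨fun heq _ he hnp => apply_add_le_of_mem_support_shear_of_shade_eq j hbj ho hr hqo heq he hnp,
    shade_step_eq_of_forall j hbj ho hr hqo ho2⟩

/-! ## 3. All layers of the new residual cone -/

/-- The `x_j`-exponent of `r′ + μ` is `(o − q) + μ_j`. [folklore] -/
theorem step_r_add_apply_self (q : ℕ) (j : Fin 4) {b : Fin 4 → K} (hbj : b j = 0) (s : State K) {o : ℕ}
    (ho : ordZero s.F = o) (hr : ∀ d ∈ s.F.support, s.r ≤ d) (μ : Fin 4 →₀ ℕ) :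
    ((CentreBlowup.step q Finset.univ j b s).r + μ) j = (o - q) + μ j := by
  rw [Finsupp.add_apply, step_r_univ q j hbj s ho hr, Finsupp.update_apply, if_pos rfl]

/-- **Deletion bites only at the layers `m ≡ 2q − o (mod q)`**: if `x^{r′ + μ}` is a `q`-th power then
`q ∣ (o − q) + μ_j`. [folklore] -/
theorem dvd_of_isPthPowerExponent_step_r_add (q : ℕ) (j : Fin 4) {b : Fin 4 → K} (hbj : b j = 0)
    (s : State K) {o : ℕ} (ho : ordZero s.F = o) (hr : ∀ d ∈ s.F.support, s.r ≤ d) {μ : Fin 4 →₀ ℕ}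
    (hP : IsPthPowerExponent q ((CentreBlowup.step q Finset.univ j b s).r + μ)) : q ∣ (o - q) + μ j := by
  have h := (isPthPowerExponent_iff q _).mp hP j
  rwa [step_r_add_apply_self q j hbj s ho hr] at h

/-- In the band no layer `m` with `o + m < 2q` is touched by the cleaning. [folklore] -/
theorem not_dvd_of_add_lt {q o m : ℕ} (hqo : q < o) (h : o + m < 2 * q) : ¬ q ∣ (o - q) + m := by
  intro hd
  have := Nat.le_of_dvd (by omega) hd
  omega

/-- Off the honest degree `d = o − |r|` the new residual cone has no coefficients. [folklore] -/
theorem coeff_resForm_step_eq_zero_of_degree_ne {q : ℕ} (j : Fin 4) {b : Fin 4 → K} (hbj : b j = 0)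
    {s : State K} {o : ℕ} (ho : ordZero s.F = o) (hr : ∀ d ∈ s.F.support, s.r ≤ d)
    (heq : (CentreBlowup.step q Finset.univ j b s).shade = s.shade) {μ : Fin 4 →₀ ℕ}
    (hμ : μ.degree ≠ o - s.r.degree) : coeff μ (resForm (CentreBlowup.step q Finset.univ j b s)) = 0 := by
  have hhom := resForm_isHomogeneous (ordZero_step_of_shade_eq j hbj ho hr heq)
  rw [Nat.add_sub_cancel_left] at hhom
  by_contra hne
  have h := hhom hne
  rw [weight_one_eq_degree] at h
  exact hμ h

/-- **ALL LAYERS OF THE NEW RESIDUAL CONE** ((VT)(ii), every layer `m = μ_j`): at a shade-keeping point step in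
the band (`x^r ∣ F`, `q < ord₀ F = o`, `b_j = 0`), for every exponent `μ` of the honest degree `d = o − |r|`,
`coeff_μ (resForm s′)` is the coefficient of `x^{top + μ + μ_j e_j}` in `shear j b F` — a monomial of the layer
`F_{o + m}`, `m = μ_j`, with `x_j`-exponent `A + 2m` — unless `x^{r′ + μ}` is a `q`-th power (then `0`).  Layer
`m = 0` is `coeff_resForm_step_of_apply_eq_zero` (`…ResConeLayer`). [OURS]
[cite: CossartJannsenSaito2020, Thm. 3.10(4), Thm. 9.3] -/
theorem coeff_resForm_step {q : ℕ} (j : Fin 4) {b : Fin 4 → K} (hbj : b j = 0) {s : State K} {o : ℕ}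
    (ho : ordZero s.F = o) (hr : ∀ d ∈ s.F.support, s.r ≤ d) (hqo : q < o)
    (heq : (CentreBlowup.step q Finset.univ j b s).shade = s.shade) {μ : Fin 4 →₀ ℕ}
    (hμ : μ.degree = o - s.r.degree) :
    coeff μ (resForm (CentreBlowup.step q Finset.univ j b s)) =
      if IsPthPowerExponent q ((CentreBlowup.step q Finset.univ j b s).r + μ) then 0
      else coeff (topMonomial j b s.r + μ + Finsupp.single j (μ j)) (shear j b s.F) := by
  have hq : (q : ℕ∞) ≤ ordAlong Finset.univ s.F := by
    rw [ordAlong_univ, ho]; exact_mod_cast hqo.le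
  have hro := degree_r_le ho hr
  have hr' := step_r_univ q j hbj s ho hr
  have ho' := ordZero_step_of_shade_eq j hbj ho hr heq
  rw [coeff_resForm]
  unfold initialForm
  rw [ho', ENat.toNat_coe, coeff_homogeneousComponent]
  have hdeg' : ((CentreBlowup.step q Finset.univ j b s).r + μ).degree =
      (CentreBlowup.step q Finset.univ j b s).r.degree + (o - s.r.degree) := by
    rw [map_add, hμ]
  rw [if_pos hdeg']
  -- the source exponent and its chart image
  have hedeg : (topMonomial j b s.r + μ + Finsupp.single j (μ j)).degree = o + μ j := by
    rw [map_add, map_add, degree_topMonomial, hμ, Finsupp.degree_single]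
    omega
  have hE : chartExponent q Finset.univ j (topMonomial j b s.r + μ + Finsupp.single j (μ j)) =
      (CentreBlowup.step q Finset.univ j b s).r + μ := by
    ext i
    by_cases hij : i = j
    · rw [hij, chartExponent_univ_apply_self, hedeg, Finsupp.add_apply, hr', Finsupp.update_apply,
        if_pos rfl]
      omega
    · rw [chartExponent_apply_of_ne q Finset.univ hij, Finsupp.add_apply, Finsupp.add_apply,
        Finsupp.add_apply, Finsupp.single_eq_of_ne hij, add_zero, hr', Finsupp.update_apply, if_neg hij,
        topMonomial_apply, if_neg hij, Finsupp.filter_apply]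
  rw [← hE]
  exact coeff_step_F_chartExponent q j hbj s hq (by rw [hedeg]; omega)

/-- **Honest layers**: if `q ∤ (o − q) + μ_j` then `coeff_μ (resForm s′) = coeff_{top + μ + μ_j e_j} (shear j b F)`
with no cleaning proviso (in the band this covers every layer `m` with `o + m < 2q`, `not_dvd_of_add_lt`; in
the isolated band `o ≤ 2q − 2` in particular the layers `0` and `1`). [OURS]
[cite: CossartJannsenSaito2020, Thm. 3.10(4), Thm. 9.3] -/
theorem coeff_resForm_step_of_not_dvd {q : ℕ} (j : Fin 4) {b : Fin 4 → K} (hbj : b j = 0) {s : State K}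
    {o : ℕ} (ho : ordZero s.F = o) (hr : ∀ d ∈ s.F.support, s.r ≤ d) (hqo : q < o)
    (heq : (CentreBlowup.step q Finset.univ j b s).shade = s.shade) {μ : Fin 4 →₀ ℕ}
    (hμ : μ.degree = o - s.r.degree) (hm : ¬ q ∣ (o - q) + μ j) :
    coeff μ (resForm (CentreBlowup.step q Finset.univ j b s)) =
      coeff (topMonomial j b s.r + μ + Finsupp.single j (μ j)) (shear j b s.F) := by
  rw [coeff_resForm_step j hbj ho hr hqo heq hμ, if_neg]
  exact fun hP => hm (dvd_of_isPthPowerExponent_step_r_add q j hbj s ho hr hP)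

/-! ## 4. Births: the layers read on the sheared residual polynomial `G = F / x^r` -/

/-- `x^r · (F /ᵐᵒⁿᵒᵐⁱᵃˡ x^r) = F` when `x^r` divides `F` monomialwise. [folklore] -/
theorem monomial_mul_divMonomial {s : State K} (hr : ∀ d ∈ s.F.support, s.r ≤ d) :
    monomial s.r (1 : K) * s.F.divMonomial s.r = s.F := by
  ext m
  rw [coeff_monomial_mul']
  split_ifs with h
  · rw [one_mul, coeff_divMonomial, add_tsub_cancel_of_le h]
  · by_contra hne
    exact h (hr m (MvPolynomial.mem_support_iff.mpr (Ne.symm hne)))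

/-- `shear j b F = shear j b (x^r) · shear j b G`, `G = F / x^r`. [folklore] -/
theorem shear_F_eq_shear_monomial_mul {s : State K} (hr : ∀ d ∈ s.F.support, s.r ≤ d) (j : Fin 4)
    (b : Fin 4 → K) :
    shear j b s.F = shear j b (monomial s.r (1 : K)) * shear j b (s.F.divMonomial s.r) := by
  rw [← shear_mul, monomial_mul_divMonomial hr]

/-- **Top × max extraction**: if `β` has the largest `x_j`-exponent among the monomials of `Q` of its degree,
then `coeff_{top + β} (shear(x^r) · Q) = coeff_top (shear x^r) · coeff_β Q` (the `x_j`-free case `β_j = 0`,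
`Q` `x_j`-free, is `coeff_topMonomial_add_mul`). [folklore] -/
theorem coeff_topMonomial_add_mul_of_forall_le (j : Fin 4) {b : Fin 4 → K} (hbj : b j = 0) (r : Fin 4 →₀ ℕ)
    {Q : MvPolynomial (Fin 4) K} {β : Fin 4 →₀ ℕ}
    (hQ : ∀ β' ∈ Q.support, β'.degree = β.degree → β' j ≤ β j) :
    coeff (topMonomial j b r + β) (shear j b (monomial r (1 : K)) * Q) =
      coeff (topMonomial j b r) (shear j b (monomial r (1 : K))) * coeff β Q := by
  rw [coeff_mul, Finset.sum_eq_single (topMonomial j b r, β)]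
  · rintro ⟨α, β'⟩ hmem hne
    rw [Finset.HasAntidiagonal.mem_antidiagonal] at hmem
    by_cases hα : α ∈ (shear j b (monomial r (1 : K))).support
    · by_cases hβ' : β' ∈ Q.support
      · exfalso
        have hαdeg : α.degree = r.degree := by
          have := Straightening.isHomogeneous_shear_monomial j b r (1 : K) (MvPolynomial.mem_support_iff.mp hα)
          rwa [weight_one_eq_degree] at this
        have hmem' : α + β' = topMonomial j b r + β := hmem
        have hdegsum : α.degree + β'.degree = (topMonomial j b r).degree + β.degree := by
          rw [← map_add, ← map_add, hmem']
        rw [degree_topMonomial, hαdeg] at hdegsum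
        have hβ'j := hQ β' hβ' (by omega)
        have hαj : α j ≤ ∑ i, r i * (if i = j ∨ b i ≠ 0 then 1 else 0) := by
          have h1 := monomial_le_degreeOf j hα
          rwa [degreeOf_shear_monomial j hbj r one_ne_zero] at h1
        have hj := congrArg (fun f : Fin 4 →₀ ℕ => f j) hmem'
        simp only [Finsupp.coe_add, Pi.add_apply, topMonomial_apply, if_true] at hj
        have hαjeq : α j = ∑ i, r i * (if i = j ∨ b i ≠ 0 then 1 else 0) := by omega
        have hαeq : α = topMonomial j b r := eq_topMonomial_of_apply_eq j hbj r hα hαjeq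
        rw [hαeq] at hmem'
        exact hne (Prod.ext hαeq (add_left_cancel hmem'))
      · rw [MvPolynomial.notMem_support_iff.mp hβ', mul_zero]
    · rw [MvPolynomial.notMem_support_iff.mp hα, zero_mul]
  · intro h
    exfalso
    apply h
    rw [Finset.HasAntidiagonal.mem_antidiagonal]

/-- **THE ABSORPTION LAW ON THE SHEARED RESIDUAL POLYNOMIAL** `G = F / x^r`: at a shade-keeping point step,
every monomial `x^β` of `shear j b G` in an HONEST degree `|β| = d + m` (`q ∤ (o − q) + m`) has `β_j ≤ 2m` (the
`(1,…,1,½)`-weighted order of `shear j b G` is `≥ d`: «the lower parts vanish = the constant-`d` condition»,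
idea-4 I-4-6 (VT)(ii)). [OURS] [cite: CossartJannsenSaito2020, Thm. 3.10(4), Thm. 9.3] -/
theorem apply_le_of_mem_support_shear_divMonomial_of_shade_eq {q : ℕ} (j : Fin 4) {b : Fin 4 → K}
    (hbj : b j = 0) {s : State K} {o : ℕ} (ho : ordZero s.F = o) (hr : ∀ d ∈ s.F.support, s.r ≤ d)
    (hqo : q < o) (heq : (CentreBlowup.step q Finset.univ j b s).shade = s.shade) {β : Fin 4 →₀ ℕ}
    (hβ : β ∈ (shear j b (s.F.divMonomial s.r)).support) (hm : ¬ q ∣ β.degree + s.r.degree - q) :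
    β j + 2 * (o - s.r.degree) ≤ 2 * β.degree := by
  have hro := degree_r_le ho hr
  -- a monomial of maximal `x_j`-exponent in the degree of `β`
  obtain ⟨βm, hβm, hmax⟩ := Finset.exists_max_image
    ((shear j b (s.F.divMonomial s.r)).support.filter fun β' => β'.degree = β.degree) (fun β' => β' j)
    ⟨β, Finset.mem_filter.mpr ⟨hβ, rfl⟩⟩
  rw [Finset.mem_filter] at hβm
  have hle : β j ≤ βm j := hmax β (Finset.mem_filter.mpr ⟨hβ, rfl⟩)
  -- `top + βm` is a monomial of `shear j b F`
  have hcoeff : coeff (topMonomial j b s.r + βm) (shear j b s.F) ≠ 0 := by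
    rw [shear_F_eq_shear_monomial_mul hr j b, coeff_topMonomial_add_mul_of_forall_le j hbj s.r
      (fun β' hβ' hdeg => hmax β' (Finset.mem_filter.mpr ⟨hβ', hdeg.trans hβm.2⟩))]
    exact mul_ne_zero (coeff_topMonomial_ne_zero j hbj s.r) (MvPolynomial.mem_support_iff.mp hβm.1)
  have h := apply_add_le_of_mem_support_shear_of_shade_eq_of_not_dvd j hbj ho hr hqo heq
    (MvPolynomial.mem_support_iff.mpr hcoeff) (by
      rw [map_add, degree_topMonomial, hβm.2, Nat.add_comm]
      exact hm)
  rw [Finsupp.add_apply, map_add, degree_topMonomial, hβm.2] at h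
  omega

/-- **THE BIRTHS** ((VT)(ii), all honest layers): at a shade-keeping point step, the coefficient of `x^μ`
(`|μ| = d`, layer `m = μ_j`, `q ∤ (o − q) + m`) in the NEW residual cone is `c · coeff_{μ + m e_j} (shear j b G)`
(`c = coeff_top (shear j b x^r) ≠ 0`, `G = F / x^r`): layer `m` of `g′` is `c ×` the `x_j^{2m}`-layer of
`G̃_{d+m}` — idea-4's `B_m`, `B₀ = c·g̃`. [OURS] [cite: CossartJannsenSaito2020, Thm. 3.10(4), Thm. 9.3] -/
theorem coeff_resForm_step_eq_mul_coeff_shear_divMonomial {q : ℕ} (j : Fin 4) {b : Fin 4 → K}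
    (hbj : b j = 0) {s : State K} {o : ℕ} (ho : ordZero s.F = o) (hr : ∀ d ∈ s.F.support, s.r ≤ d)
    (hqo : q < o) (heq : (CentreBlowup.step q Finset.univ j b s).shade = s.shade) {μ : Fin 4 →₀ ℕ}
    (hμ : μ.degree = o - s.r.degree) (hm : ¬ q ∣ (o - q) + μ j) :
    coeff μ (resForm (CentreBlowup.step q Finset.univ j b s)) =
      coeff (topMonomial j b s.r) (shear j b (monomial s.r (1 : K))) *
        coeff (μ + Finsupp.single j (μ j)) (shear j b (s.F.divMonomial s.r)) := by
  have hro := degree_r_le ho hr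
  rw [coeff_resForm_step_of_not_dvd j hbj ho hr hqo heq hμ hm, add_assoc, shear_F_eq_shear_monomial_mul hr j b,
    coeff_topMonomial_add_mul_of_forall_le j hbj s.r]
  intro β' hβ' hdeg
  rw [map_add, Finsupp.degree_single, hμ] at hdeg
  have h := apply_le_of_mem_support_shear_divMonomial_of_shade_eq j hbj ho hr hqo heq hβ' (by
    rw [hdeg, show o - s.r.degree + μ j + s.r.degree - q = o - q + μ j by omega]
    exact hm)
  rw [hdeg] at h
  rw [Finsupp.add_apply, Finsupp.single_eq_same]
  omega

/-- **The births below the cleaning threshold**: every layer `m` with `o + m < 2q` is honest, so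
`coeff_μ (resForm s′) = c · coeff_{μ + m e_j} (shear j b G)` there; in the isolated band `o ≤ 2q − 2` this is
every layer `m ≤ 1` — layer `1` carries the chart-letter coefficient of the new contact form on a power-cone
(slice B) or binary-cone (slice C) stretch. [OURS] [cite: CossartJannsenSaito2020, Thm. 3.10(4), Thm. 9.3] -/
theorem coeff_resForm_step_eq_mul_coeff_shear_divMonomial_of_add_lt {q : ℕ} (j : Fin 4) {b : Fin 4 → K}
    (hbj : b j = 0) {s : State K} {o : ℕ} (ho : ordZero s.F = o) (hr : ∀ d ∈ s.F.support, s.r ≤ d)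
    (hqo : q < o) (heq : (CentreBlowup.step q Finset.univ j b s).shade = s.shade) {μ : Fin 4 →₀ ℕ}
    (hμ : μ.degree = o - s.r.degree) (hlt : o + μ j < 2 * q) :
    coeff μ (resForm (CentreBlowup.step q Finset.univ j b s)) =
      coeff (topMonomial j b s.r) (shear j b (monomial s.r (1 : K))) *
        coeff (μ + Finsupp.single j (μ j)) (shear j b (s.F.divMonomial s.r)) :=
  coeff_resForm_step_eq_mul_coeff_shear_divMonomial j hbj ho hr hqo heq hμ (not_dvd_of_add_lt hqo hlt)

end Step

end ResCone

end Summit.ResolutionOfSingularities.ResolutionOfSingularities.Theorems.PIDim4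

end
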